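import Literature.AlgebraicGeometry.Motives.UniversalHypersurfaceRegularLocusCoordinates
import HarnessLib

/-!
# The equation of the regular locus `𝒴°`: a point lies on the hypersurface of its own form

Family `hodge`, layer `Literature/AlgebraicGeometry/Motives`; sequel of `UniversalHypersurfaceRegularLocusCoordinates`
(coefficient homomorphism `regPointHom`, vector `regCoeff`, form `regForm = Σ_m b_m x^m` of a point of the regular locus
`𝒴° = regularTotal k n d` of the universal hypersurface, and its projection `regularToProjectiveSpace : 𝒴° → ℙⁿ⁺¹_k`).
Here: **the homogeneous coordinates `[z]` of a complex point `Q ∈ 𝒴°(ℂ)` satisfy `Σ_m b_m(Q) z^m = 0`**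
(`hypersurfacePoint_mem_projZeroLocus_regForm`, `eval_rep_formOfCoeffs_regCoeff`) — the defining incidence
`𝒴 = {(x, F) | F(x) = 0} ⊆ ℙⁿ⁺¹ × S^d` (Voisin II §6.2.1) read on complex points, INCLUDING the points over singular
forms (which the fibre-by-fibre identification `𝒴_s ≅ X_{F_s}` of `UniversalHypersurfaceFibre`, stated over the smooth
locus `U`, does not reach). Proof: the `K`-point `Q ≫ (𝒴° ↪ ℙⁿ⁺¹_R)` lifts to the fibre `ℙⁿ⁺¹_K = ℙⁿ⁺¹_R ×_{S^d} Spec K`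
over the coefficient homomorphism of `Q` (`regProjMap`, `regFiberLift`; `ProjBaseChangeRing.isPullback_projMap'`), the
lift lies on `V₊(F_Q)` because `𝒴 ↪ ℙⁿ⁺¹_R` has image `V₊(F)` (`range_totalι`) and the base change contracts homogeneous
primes along `F ↦ F_Q`; over `K = k = ℂ` the lift IS `Q ≫ (𝒴° → ℙⁿ⁺¹_ℂ)` (`Proj.map_comp`, `Proj.map_id`), and scheme
points in `V₊(G)` have homogeneous coordinates in the projective zero locus of `G`
(`preimage_projPoint_setOf_pt_mem_basicOpen`).

Everything is proved; the two definitions (`regProjMap`, `regFiberLift`) are concrete; no named facts.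

## References

* [VoisinHodgeII2003] C. Voisin, Hodge Theory and Complex Algebraic Geometry II (2003), §6.2.1.
* [Hartshorne1977] R. Hartshorne, Algebraic Geometry (1977), II.3 (fibre products), II Ex. 2.7.
* [SerreGAGA1956] J.-P. Serre, Géométrie algébrique et géométrie analytique, Ann. Inst. Fourier 6 (1956), §2 n°5.
-/

noncomputable section

open CategoryTheory CategoryTheory.Limits AlgebraicGeometry MvPolynomial TopologicalSpace

universe u

namespace Literature.AlgebraicGeometry.Motives.UniversalHypersurface

attribute [local instance] MvPolynomial.gradedAlgebra ProjBaseChange.algebraBase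
  ProjBaseChange.isScalarTower_localization

/-! ### §5 The equation: a point of `𝒴°` lies on the hypersurface of its own form -/

section Equation

variable (k : Type u) [Field k] (n d : ℕ) {K : Type u} [Field K] [Algebra k K]

/-- `Proj` of a graded endomorphism of `R[x₀, …, x_m]` which is pointwise the identity is the identity
(Mathlib `Proj.map_id`). [cite: Hartshorne1977, II Ex. 2.14 (functoriality of Proj)] -/
private theorem Proj_map_eq_id_of_forall_eq {R : Type u} [CommRing R] {m : ℕ}
    (f : MvPolynomial.homogeneousSubmodule (Fin m) R →+*ᵍ MvPolynomial.homogeneousSubmodule (Fin m) R)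
    (hf : HomogeneousIdeal.irrelevant (MvPolynomial.homogeneousSubmodule (Fin m) R) ≤
      (HomogeneousIdeal.irrelevant (MvPolynomial.homogeneousSubmodule (Fin m) R)).map f)
    (h : ∀ x, f x = x) : Proj.map f hf = 𝟙 (Proj (MvPolynomial.homogeneousSubmodule (Fin m) R)) := by
  have hid : f = GradedRingHom.id (MvPolynomial.homogeneousSubmodule (Fin m) R) := GradedRingHom.ext h
  subst hid
  exact Proj.map_id

/-- A homogeneous polynomial is homogeneous of degree its total degree (Mathlib `IsHomogeneous.totalDegree`).
[cite: Hartshorne1977, I §2 (graded rings, p. 9)] -/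
private theorem isHomogeneous_totalDegree_of_isHomogeneous {σ : Type*} {S : Type*} [CommSemiring S]
    {q : MvPolynomial σ S} {m : ℕ} (hq : q.IsHomogeneous m) : q.IsHomogeneous q.totalDegree := by
  by_cases h0 : q = 0
  · rw [h0]; exact MvPolynomial.isHomogeneous_zero _ _ _
  · rwa [hq.totalDegree h0]

/-- The base change `ℙⁿ⁺¹_K → ℙⁿ⁺¹_R` along the coefficient homomorphism of a `K`-point `Q` of `𝒴°`
(Mathlib `Proj.map` of `R[x] → K[x]`; as `projMapPoint` for points of `U`). [cite: Hartshorne1977, II.3 (base change)] -/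
def regProjMap (Q : AlgPoints (regularTotal k n d) K) : projSp n K ⟶ projSp n (CoeffRing k n d) :=
  letI : Algebra (CoeffRing k n d) K := (regPointHom k n d Q).hom.toAlgebra
  Proj.map (ProjBaseChangeRing.mapGraded (CoeffRing k n d) K (Fin (n + 2)))
    (ProjBaseChangeRing.irrelevant_le_map (CoeffRing k n d) K (Fin (n + 2)))

/-- `ℙⁿ⁺¹_K = ℙⁿ⁺¹_R ×_{S^d} Spec K` over the coefficient homomorphism of `Q`
(`ProjBaseChangeRing.isPullback_projMap'`). [cite: Hartshorne1977, II.3] -/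
theorem isPullback_regProjMap (Q : AlgPoints (regularTotal k n d) K) :
    IsPullback (regProjMap k n d Q) (projSpToSpec n K) (projSpToSpec n (CoeffRing k n d))
      (Spec.map (regPointHom k n d Q)) := by
  letI : Algebra (CoeffRing k n d) K := (regPointHom k n d Q).hom.toAlgebra
  have h := ProjBaseChangeRing.isPullback_projMap' (CoeffRing k n d) K (n := n + 1)
  have halg : CommRingCat.ofHom (algebraMap (CoeffRing k n d) K) = regPointHom k n d Q := by
    ext1; rfl
  rw [halg] at h
  exact h

/-- On points, `regProjMap Q` contracts homogeneous primes along `F ↦ F_Q`: `G ∈ 𝔭_{image}` iff `G_Q ∈ 𝔭`.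
[cite: Hartshorne1977, II Ex. 2.14 (b) and II.3] -/
theorem mem_regProjMap_apply_iff (Q : AlgPoints (regularTotal k n d) K) (q : projSp n K)
    (G : MvPolynomial (Fin (n + 2)) (CoeffRing k n d)) :
    G ∈ (regProjMap k n d Q q).asHomogeneousIdeal ↔
      MvPolynomial.map (regPointHom k n d Q).hom G ∈ q.asHomogeneousIdeal :=
  Iff.rfl

/-- **The fibre lift of a `K`-point of `𝒴°`**: the `K`-point of `ℙⁿ⁺¹_K` with components `Q ≫ (𝒴° ↪ 𝒴 ↪ ℙⁿ⁺¹_R)`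
and `𝟙_{Spec K}`. [cite: Hartshorne1977, II.3] -/
def regFiberLift (Q : AlgPoints (regularTotal k n d) K) : Spec (.of K) ⟶ projSp n K :=
  (isPullback_regProjMap k n d Q).lift (Q.toSpecHom ≫ regularTotalι k n d) (𝟙 _) (by
    rw [Category.id_comp, Spec_map_regPointHom, Category.assoc, regularToSpec'_eq])

/-- `regFiberLift Q ≫ (ℙⁿ⁺¹_K → ℙⁿ⁺¹_R) = Q ≫ (𝒴° ↪ ℙⁿ⁺¹_R)`. [cite: Hartshorne1977, II.3] -/
@[reassoc]
theorem regFiberLift_comp_regProjMap (Q : AlgPoints (regularTotal k n d) K) :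
    regFiberLift k n d Q ≫ regProjMap k n d Q = Q.toSpecHom ≫ regularTotalι k n d :=
  IsPullback.lift_fst _ _ _ _

/-- **The fibre lift lies on `V₊(F_Q)`**: the image of `Q` in `ℙⁿ⁺¹_R` lies on `V₊(F)` (`range_totalι`), and
`regProjMap Q` pulls `F` back to `F_Q`. [cite: VoisinHodgeII2003, §6.2.1] -/
theorem regFiberLift_base_mem_zeroLocus (Q : AlgPoints (regularTotal k n d) K) (x : Spec (.of K)) :
    (regFiberLift k n d Q).base x ∈
      ProjectiveSpectrum.zeroLocus (MvPolynomial.homogeneousSubmodule (Fin (n + 2)) K) {regForm k n d Q} := by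
  have hmem : (regProjMap k n d Q).base ((regFiberLift k n d Q).base x) ∈
      ProjectiveSpectrum.zeroLocus (MvPolynomial.homogeneousSubmodule (Fin (n + 2)) (CoeffRing k n d))
        {universalForm k n d} := by
    have h1 : (regProjMap k n d Q).base ((regFiberLift k n d Q).base x) =
        (regularTotalι k n d).base (Q.toSpecHom.base x) := by
      have := congrArg (fun f => f.base x) (regFiberLift_comp_regProjMap k n d Q)
      simpa only [Scheme.Hom.comp_apply] using this
    rw [h1]
    exact range_regularTotalι_subset k n d (Set.mem_range_self _)
  have hsub : ({universalForm k n d} : Set (MvPolynomial (Fin (n + 2)) (CoeffRing k n d))) ⊆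
      ((regProjMap k n d Q).base ((regFiberLift k n d Q).base x) :
        ProjectiveSpectrum _).asHomogeneousIdeal := hmem
  rw [Set.singleton_subset_iff, SetLike.mem_coe, mem_regProjMap_apply_iff] at hsub
  change ({regForm k n d Q} : Set (MvPolynomial (Fin (n + 2)) K)) ⊆ _
  rw [Set.singleton_subset_iff, SetLike.mem_coe]
  exact hsub

end Equation

section EquationComplex

variable (n d : ℕ)

/-- Over `k = K = ℂ`, `regFiberLift Q` IS the point `Q ≫ (𝒴° → ℙⁿ⁺¹_ℂ)`: the composite base change
`ℙⁿ⁺¹_ℂ → ℙⁿ⁺¹_R → ℙⁿ⁺¹_ℂ` along `ℂ → R → ℂ` is the identity (`Proj.map_comp`, `Proj.map_id`; the coefficient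
homomorphism is a `ℂ`-algebra map). [cite: Hartshorne1977, II.3] -/
theorem map_regularToProjectiveSpace_left (Q : ComplexPoints (regularTotal ℂ n d)) :
    (AlgPoints.map (regularToProjectiveSpace ℂ n d) Q).left = regFiberLift ℂ n d Q := by
  letI : Algebra (CoeffRing ℂ n d) ℂ := (regPointHom ℂ n d Q).hom.toAlgebra
  have hcomp : regProjMap ℂ n d Q ≫ HodgeTheory.UniversalHypersurface.projSpToProjSp ℂ n d = 𝟙 _ := by
    rw [regProjMap, HodgeTheory.UniversalHypersurface.projSpToProjSp, ← Proj.map_comp]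
    refine Proj_map_eq_id_of_forall_eq _ _ fun x => ?_
    change MvPolynomial.map (algebraMap (CoeffRing ℂ n d) ℂ) (MvPolynomial.map (algebraMap ℂ (CoeffRing ℂ n d)) x) = x
    rw [MvPolynomial.map_map, RingHom.algebraMap_toAlgebra, regPointHom_comp_algebraMap, Algebra.algebraMap_self,
      MvPolynomial.map_id]
  change Q.toSpecHom ≫ regularTotalι ℂ n d ≫ HodgeTheory.UniversalHypersurface.projSpToProjSp ℂ n d = _
  rw [← reassoc_of% (regFiberLift_comp_regProjMap ℂ n d Q), hcomp, Category.comp_id]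

/-- **A complex point of `𝒴°` lies on the hypersurface of its own form**: the homogeneous coordinates `[z]` of
`Q ∈ 𝒴°(ℂ)` satisfy `F_Q(z) = Σ_m b_m(Q) z^m = 0`. [cite: VoisinHodgeII2003, §6.2.1] [cite: SerreGAGA1956, §2 n°5] -/
theorem hypersurfacePoint_mem_projZeroLocus_regForm (Q : ComplexPoints (regularTotal ℂ n d)) :
    HodgeTheory.hypersurfacePoint (regularToProjectiveSpace ℂ n d) Q ∈
      Projectivization.projZeroLocus {regForm ℂ n d Q} := by
  have hpt : (AlgPoints.map (regularToProjectiveSpace ℂ n d) Q).pt ∈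
      ProjectiveSpectrum.zeroLocus (MvPolynomial.homogeneousSubmodule (Fin (n + 2)) ℂ) {regForm ℂ n d Q} := by
    change (AlgPoints.map (regularToProjectiveSpace ℂ n d) Q).toSpecHom.base (IsLocalRing.closedPoint ℂ) ∈ _
    have hl : (AlgPoints.map (regularToProjectiveSpace ℂ n d) Q).toSpecHom = regFiberLift ℂ n d Q :=
      map_regularToProjectiveSpace_left n d Q
    rw [hl]
    exact regFiberLift_base_mem_zeroLocus ℂ n d Q _
  by_contra hP
  have hmem : HodgeTheory.hypersurfacePoint (regularToProjectiveSpace ℂ n d) Q ∈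
      Literature.NumberTheory.Transcendental.projPoint (n + 1) ⁻¹'
        {P | P.pt ∈ Proj.basicOpen (MvPolynomial.homogeneousSubmodule (Fin (n + 2)) ℂ) (regForm ℂ n d Q)} := by
    rw [Literature.NumberTheory.Transcendental.preimage_projPoint_setOf_pt_mem_basicOpen (n + 1) _ d
      (isHomogeneous_regForm ℂ n d Q)]
    exact hP
  rw [Set.mem_preimage, Set.mem_setOf_eq, HodgeTheory.projPoint_hypersurfacePoint] at hmem
  have hsub : ({regForm ℂ n d Q} : Set (MvPolynomial (Fin (n + 2)) ℂ)) ⊆ _ := hpt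
  exact ((Proj.mem_basicOpen _ _ _).mp hmem) (Set.singleton_subset_iff.mp hsub)

/-- The same in coordinates: for every representative `z` of the homogeneous coordinates of `Q`,
`Σ_m b_m(Q) z^m = 0`. [cite: VoisinHodgeII2003, §6.2.1] -/
theorem eval_rep_formOfCoeffs_regCoeff (Q : ComplexPoints (regularTotal ℂ n d)) :
    MvPolynomial.eval (HodgeTheory.hypersurfacePoint (regularToProjectiveSpace ℂ n d) Q).rep
      (formOfCoeffs (regCoeff ℂ n d Q)) = 0 := by
  have h := hypersurfacePoint_mem_projZeroLocus_regForm n d Q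
  rw [regForm_eq_formOfCoeffs, ← Projectivization.mk_rep (HodgeTheory.hypersurfacePoint _ Q),
    Projectivization.mem_projZeroLocus_mk_iff (by
      rintro G rfl
      exact isHomogeneous_totalDegree_of_isHomogeneous (isHomogeneous_formOfCoeffs (regCoeff ℂ n d Q)))] at h
  simpa using h

end EquationComplex

end Literature.AlgebraicGeometry.Motives.UniversalHypersurface

end
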